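import Summits.HodgeConjecture.HodgeConjecture.Theorems.F0P3U3LengthLeTwoOfEmbeds          -- ★ (this seat) J1: `nontrivial_coinvariants_of_isConstituentOf_cmPrincipalSeries`, `isSmooth_cmPrincipalSeries`
import Summits.HodgeConjecture.HodgeConjecture.Theorems.F0P3bCentralCharacterUnitaryNonsplit -- ★ p827424 (A-p01 (g17)) G3: `norm_centralChar_eq_one_of_nonsplit`
import Literature.NumberTheory.Automorphic.U3PrincipalSeriesLettersUnfold                    -- ★ (this seat): N5 ∕ N5′ ∕ N2 UNFOLDED (`…_iff` bridges to theorem-world)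
import Literature.NumberTheory.Automorphic.U3PrincipalSeriesJacquetFiltrationUnfold          -- ★ (this seat): N1 conjuncts 1–2 unfolded
import Literature.NumberTheory.Automorphic.CMXiTorusCharSplitTorusDecay                       -- ★ p826744 (typ-T3b): `torusDet_eq_one_of_torusEntry`
import Literature.NumberTheory.Automorphic.SmoothInductionAdmissibleOfCocompact               -- ★ `isAdmissible_cmPrincipalSeries_of_iwasawa`
import Literature.NumberTheory.Automorphic.UnitaryGroupCMLocalIwasawa                        -- ★ `exists_borel_mul_mem_cmLocalIntegralLevel` (Iwasawa at every finite place)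
import HarnessLib

/-!
# `F0P3U3SubrepSquareIntegrableOfExponents` — the T3 junction **N5′ ⇐ N5 + N1 + N2**: every proper `G`-stable subspace of `i_G(χ)` is
# square-integrable modulo the centre when `χ₁` decays on the split torus (Casselman's Prop. 7.1.3 for `U(3)(L⁺_v)`, derived)

Cell `hodgecm-mathlib`, F0∕P3 «U3-mult», crux H413 (`stmt-HodgeConjecture-24833`); T3 «KeysCaseTwo» pay-down (typ-T3a∕T3b (g0), desk
F0P3b-plan (g8)); pen A-p01 (g18).  The letter N5′ ★ `UnitaryGroup.U3PrincipalSeriesSubrepSquareIntegrable` [Casselman1995, Prop. 7.1.3] is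
DERIVED — token for token — from N5 ★ `UnitaryGroup.U3SquareIntegrableExponents` [Casselman1995, Thm 4.4.6] (square-integrability ⇔ decay of
the exponents), N1 ★ `UnitaryGroup.U3PrincipalSeriesJacquetFiltration` [L. 7.1.1 (a)] and N2 ★ `UnitaryGroup.U3PrincipalSeriesConstituentEmbeds`
[Cor. 6.3.9 (b)], following the printed six-line proof of Prop. 7.1.3:

* §1 the CENTRAL CHARACTER of `i_G(χ)` at a non-split `v`: central elements are scalars `u · 1` (★ `forall_mem_center_cmLocal_eq_scalar`), hence
  lie in `B` (`center_le_cmBorelU`), and `z ∈ Z(G) ∩ B` acts on the induced model by the scalar `δ_B^{1/2}(z) χ(z)` (generic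
  `smoothIndRep_apply_of_mem_center_of_apply_eq_smul`; `exists_centralChar_cmPrincipalSeries`).
* §2 **`u3PrincipalSeriesSubrepSquareIntegrable_of_exponents (hN5) (hN1) (hN2) : U3PrincipalSeriesSubrepSquareIntegrable L`** (in
  theorem-world via the `Iff.rfl` bridges ★ `U3PrincipalSeriesLettersUnfold` ∕ ★ `U3PrincipalSeriesJacquetFiltrationUnfold`): for
  `⊥ ≠ N ≠ ⊤`, `dim r_B(N) = 1` (★ `Representation.finrank_coinvariants_eq_one_of_ne_bot_of_ne_top`, over J1's «every constituent has
  `r_B ≠ 0`» and ★ p827635 exactness), the embedding `N ↪ i_G(χ) = normalizedInd (cmBorelTriple L 3 v) ℂ_χ` is non-zero, so every exponent of `N` IS `χ`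
  (★ `Representation.apply_eq_of_eigenvector_of_finrank_eq_one_of_intertwiningMap_normalizedInd`, Frobenius inside); `N` is admissible
  (★ `isAdmissible_cmPrincipalSeries_of_iwasawa` + ★ `IsAdmissible.toRepresentation`) with unitary central character (§1 + ★ G3), so N5 (⇐)
  applies once `‖χ(d(a, 1, a⁻¹))‖ = ‖χ₁(a)‖ < 1` (★ `torusDet_eq_one_of_torusEntry`; the decay hypothesis of N5′); `N = ⊥` is square-integrable
  trivially (all matrix coefficients vanish).

BOOKS EFFECT: in either registered T3 cut, `stub_N5' := u3PrincipalSeriesSubrepSquareIntegrable_of_exponents L stub_N5 stub_N1 stub_N2` — N5′ stops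
being a letter; with J1 the T3 letters are {N4 [Keys1984 §7 Thm (2)], N5 [Casselman1995 Thm 4.4.6], N1 (payable), N2 [Casselman1995 Cor. 6.3.9 (b)]}.
HONEST LABEL: N5, N1, N2 remain HYPOTHESES of record; HC_CM is proved only modulo the printed citations until rung 0 closes.
[Casselman1995 Prop. 7.1.3 p. 67, Thm 4.4.6 p. 45, Thm 3.2.4; BernsteinZelevinsky1977 Prop. 1.9 (b); Rogawski1990 §12.2 (2) pp. 173–174]
-/

set_option autoImplicit false
set_option linter.dupNamespace false

noncomputable section

open NumberField IsDedekindDomain MeasureTheory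
open Literature.NumberTheory.Automorphic Literature.NumberTheory.Automorphic.UnitaryGroup
open Literature.RepresentationTheory.FiniteGroups Literature.RepresentationTheory.Semisimple
open scoped Matrix MatrixGroups

namespace Summit.HodgeConjecture.HodgeConjecture.Cruxes.H413.F0P3U3SubrepSquareIntegrableOfExponents

/-! ## §0 Generic: a central element of `H` acting on `σ` by a scalar acts on `Ind_H^G σ` by the same scalar -/

/-- **Central elements act on an induced representation through the inducing representation**: if `z ∈ Z(G) ∩ H` and `σ(z) = c · id`, then
`(Ind_H^G σ)(z) f = c · f` (right translation by a central `z` is left translation, and `f(z x) = σ(z) f(x)`); the pattern of ★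
`parabolicIndGL_apply_of_mem_center`. [cite: BushnellHenniart2006, §2.4; §2.6] [cite: BernsteinZelevinsky1976, §2.21] -/
theorem smoothIndRep_apply_of_mem_center_of_apply_eq_smul {k G W : Type*} [CommRing k] [Group G] [TopologicalSpace G]
    [SeparatelyContinuousMul G] [AddCommGroup W] [Module k W] (H : Subgroup G) (σ : Representation k H W) {z : G} (hz : z ∈ Subgroup.center G) (hzH : z ∈ H)
    {c : k} (hσ : ∀ w, σ ⟨z, hzH⟩ w = c • w) (f : Representation.SmoothInd H σ) :
    Representation.smoothIndRep H σ z f = c • f := by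
  refine Representation.SmoothInd.ext (funext fun x => ?_)
  rw [Representation.toFun_smoothIndRep_apply, Representation.SmoothInd.toFun_smul, Pi.smul_apply, Subgroup.mem_center_iff.1 hz x]
  have h := f.toFun_subgroup_mul ⟨z, hzH⟩ x
  rw [Subgroup.coe_mk] at h
  rw [h, hσ]

variable (L : Type) [Field L] [NumberField L] [IsCMField L] (v : HeightOneSpectrum (𝓞 ↥(maximalRealSubfield L)))

/-! ## §1 The central character of `i_G(χ)` at a non-split place -/

/-- **At a non-split `v`, the centre of `U(Φ₃)(L⁺_v)` lies in the Borel `B`** (central elements are scalars `u · 1`, ★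
`forall_mem_center_cmLocal_eq_scalar` at the split form `Φ₃` — ★ `antidiagOne_isHermitian`, ★ `isUnit_antidiagOne_det` — and scalar matrices
are upper-triangular, Mathlib `Matrix.blockTriangular_diagonal`). [cite: Rogawski1990, §1.10 p. 9; §12.2 p. 173] [cite: PlatonovRapinchuk1994, §2.3] -/
theorem center_le_cmBorelU (hns : ∀ w : PlacesOver L v, IsCMField.complexConj L • w.1 = w.1) :
    Subgroup.center ↥(unitaryGroupOfForm (conjLocal L (IsCMField.complexConj L) v) (cmLocalForm L 3 v)) ≤ (cmBorelTriple L 3 v).P := by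
  intro z hz
  obtain ⟨u, hu⟩ := forall_mem_center_cmLocal_eq_scalar L
    (Matrix.of fun i j : Fin 3 => if i.val + j.val + 1 = 3 then (1 : L) else 0) (antidiagOne_isHermitian L 3) (isUnit_antidiagOne_det L 3)
    v hns z hz
  change z ∈ borelU (conjLocal L (IsCMField.complexConj L) v) (cmLocalForm L 3 v)
  rw [mem_borelU_iff, hu, Matrix.GeneralLinearGroup.coe_scalar, Matrix.scalar_apply]
  exact Matrix.blockTriangular_diagonal _

set_option synthInstance.maxHeartbeats 400000 in  -- `Module ℂ` on the carrier of `cmPrincipalSeries` (as in ★ N1's statement file)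
set_option maxHeartbeats 1000000 in  -- one crossing `cmPrincipalSeries … z f = smoothIndRep … z f` in applied form (measured: > 2·10⁵, wall ≈ 35 s)
/-- **The principal series `i_G(χ)` has a central character at a non-split `v`**: there is `ω : Z(G) →* ℂˣ` — namely
`ω(z) = δ_B^{1/2}(z) · χ(proj z)` on `Z(G) ≤ B` — with `i_G(χ)(z) f = ω(z) · f` for all `f`. [cite: BushnellHenniart2006, §2.6]
[cite: Rogawski1990, §12.1 p. 171; §12.2 p. 173] -/
theorem exists_centralChar_cmPrincipalSeries (hns : ∀ w : PlacesOver L v, IsCMField.complexConj L • w.1 = w.1)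
    (χ : ↥(torusU (conjLocal L (IsCMField.complexConj L) v) (cmLocalForm L 3 v)) →* ℂˣ) :
    ∃ ω : ↥(Subgroup.center ↥(unitaryGroupOfForm (conjLocal L (IsCMField.complexConj L) v) (cmLocalForm L 3 v))) →* ℂˣ,
      ∀ (z : ↥(Subgroup.center ↥(unitaryGroupOfForm (conjLocal L (IsCMField.complexConj L) v) (cmLocalForm L 3 v)))) (f),
        cmPrincipalSeries L 3 v χ (z : ↥(unitaryGroupOfForm (conjLocal L (IsCMField.complexConj L) v) (cmLocalForm L 3 v))) f =
          ((ω z : ℂˣ) : ℂ) • f := by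
  haveI := locallyCompactSpace_cmBorelU L 3 v
  refine ⟨(rootDeltaChar (cmBorelTriple L 3 v).P * χ.comp (cmBorelTriple L 3 v).proj).comp
    (Subgroup.inclusion (center_le_cmBorelU L v hns)), fun z f => ?_⟩
  have hzB : (z : ↥(unitaryGroupOfForm (conjLocal L (IsCMField.complexConj L) v) (cmLocalForm L 3 v))) ∈ (cmBorelTriple L 3 v).P :=
    center_le_cmBorelU L v hns z.2
  exact smoothIndRep_apply_of_mem_center_of_apply_eq_smul (cmBorelTriple L 3 v).P
    (Representation.twist
      (((Representation.trivial ℂ ↥(torusU (conjLocal L (IsCMField.complexConj L) v) (cmLocalForm L 3 v)) ℂ).twist χ).comp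
        (cmBorelTriple L 3 v).proj) (rootDeltaChar (cmBorelTriple L 3 v).P)) z.2 hzB
    (c := ((rootDeltaChar (cmBorelTriple L 3 v).P ⟨z, hzB⟩ : ℂˣ) : ℂ) * ((χ ((cmBorelTriple L 3 v).proj ⟨z, hzB⟩) : ℂˣ) : ℂ))
    (fun w => by
      rw [Representation.twist_apply, MonoidHom.comp_apply, Representation.twist_apply, Representation.trivial_apply, smul_smul]) f

/-! ## §2 The junction N5′ ⇐ N5 + N1 + N2 -/

/-- The zero representation is square-integrable modulo the centre (all its matrix coefficients vanish; dominated by `0 ∈ L²`).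
[cite: Casselman1995, §2.5 p. 28] -/
theorem isSquareIntegrableModCenter_of_subsingleton {G V : Type*} [Group G] [TopologicalSpace G] [SeparatelyContinuousMul G]
    [AddCommGroup V] [Module ℂ V] [Subsingleton V] [MeasurableSpace (G ⧸ Subgroup.center G)] (ρ : Representation ℂ G V) (μ : Measure (G ⧸ Subgroup.center G)) :
    ρ.IsSquareIntegrableModCenter μ := by
  intro φ _ x
  refine ⟨fun _ => 0, MemLp.zero', fun g => ?_⟩
  rw [Representation.matrixCoeff, Subsingleton.elim (ρ g x) 0, map_zero, norm_zero]

set_option synthInstance.maxHeartbeats 400000 in  -- `Module ℂ ↥N` for the central-character identity on the subrepresentation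
set_option maxHeartbeats 2000000 in  -- ≈ a dozen carrier-level elaborations at 2–5·10⁴ heartbeats each (measured one by one; none alone exceeds the default)
/-- **THE JUNCTION N5′ ⇐ N5 + N1 + N2** (Casselman's Prop. 7.1.3 for `U(3)(L⁺_v)` at a non-split `v`, derived; proof in the module docstring).
[cite: Casselman1995, Prop. 7.1.3 p. 67; Thm 4.4.6 p. 45] [cite: BernsteinZelevinsky1977, Prop. 1.9 (b)] [cite: Rogawski1990, §12.2 pp. 173–174] -/
theorem u3PrincipalSeriesSubrepSquareIntegrable_of_exponents (hN5 : U3SquareIntegrableExponents L)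
    (hN1 : U3PrincipalSeriesJacquetFiltration L) (hN2 : U3PrincipalSeriesConstituentEmbeds L) :
    U3PrincipalSeriesSubrepSquareIntegrable L := by
  refine (U3PrincipalSeriesSubrepSquareIntegrable_iff L).2 fun v hns χ₁ χ₂ h1c h2c hdecay => ?_
  intro _ _ μZ _ N hNtop
  haveI := locallyCompactSpace_cmBorelU L 3 v
  by_cases hNbot : N = ⊥
  · subst hNbot
    haveI : Subsingleton ↥(⊥ : Subrepresentation (cmPrincipalSeries L 3 v (cmTorusCharPair L v χ₁ χ₂))).toSubmodule :=
      ⟨fun a b => Subtype.ext (((Submodule.mem_bot ℂ).1 a.2).trans ((Submodule.mem_bot ℂ).1 b.2).symm)⟩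
    exact isSquareIntegrableModCenter_of_subsingleton _ μZ
  -- `⊥ ≠ N ≠ ⊤`.  (No type ascriptions below: every intermediate type is taken from the lemma that produces it, so that no
  -- carrier-level term is re-elaborated in this file — see ★ `U3PrincipalSeriesLettersUnfold` for why that matters.)
  -- N1 (unfolded): `r_B i_G(χ)` is finite-dimensional of dimension 2
  have key := finiteDimensional_finrank_eq_two_of_U3PrincipalSeriesJacquetFiltration L hN1 v hns χ₁ χ₂ h1c h2c
  have hsm := F0P3U3LengthLeTwoOfEmbeds.isSmooth_cmPrincipalSeries L v (cmTorusCharPair L v χ₁ χ₂)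
  -- `dim r_B(N) = 1`
  have h1 := @Representation.finrank_coinvariants_eq_one_of_ne_bot_of_ne_top _ _ _ _ (cmBorelTriple L 3 v) _ _ _
    (cmPrincipalSeries L 3 v (cmTorusCharPair L v χ₁ χ₂))
    (F0P3UnipotentLimitCompactOpen.isLimitOfCompactOpen_cmUnipotentU L v) hsm
    (F0P3U3LengthLeTwoOfEmbeds.nontrivial_coinvariants_of_isConstituentOf_cmPrincipalSeries L hN2 v hns χ₁ χ₂ h1c h2c)
    key.1 key.2 N hNbot hNtop
  -- the embedding `N ↪ i_G(χ)` is a non-zero `G`-map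
  have hf0 := Subrepresentation.subtypeIntertwiningMap_ne_zero hNbot
  -- `N` is admissible, with a unitary central character
  have hadm := (isAdmissible_cmPrincipalSeries_of_iwasawa L 3 v (exists_borel_mul_mem_cmLocalIntegralLevel L 3 v)
    (cmTorusCharPair L v χ₁ χ₂)).toRepresentation N
  -- (`Exists.elim`, not `obtain`: `rcases` on carrier-level statements is itself a heartbeat trap here)
  refine (exists_centralChar_cmPrincipalSeries L v hns (cmTorusCharPair L v χ₁ χ₂)).elim fun ω hω => ?_
  haveI : Nontrivial ↥N.toSubmodule :=
    Submodule.nontrivial_iff_ne_bot.2 fun h => hNbot (Subrepresentation.toSubmodule_injective h)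
  have hnorm := F0P3bCentralCharacterUnitaryNonsplit.norm_centralChar_eq_one_of_nonsplit L 3 v hns N.toRepresentation
    (hsm.toRepresentation N) ω (fun z x => Subtype.ext (hω z x))
  -- N5 (⇐, unfolded): it remains to check that every exponent decays — and every exponent IS `χ`
  refine (((U3SquareIntegrableExponents_iff L).1 hN5 v hns μZ ↥N.toSubmodule N.toRepresentation hadm ω
    (fun z x => Subtype.ext (hω z x))).2 ⟨hnorm, ?_⟩).2
  intro χ' hχ' a hfix h1a hlt
  refine hχ'.elim fun w hw => ?_
  rw [Representation.apply_eq_of_eigenvector_of_finrank_eq_one_of_intertwiningMap_normalizedInd (cmBorelTriple L 3 v)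
    N.toRepresentation (F0P2nBorelCharactersUnipotent.deltaChar_cmBorel_eq_one L v) (hsm.toRepresentation N) (cmTorusCharPair L v χ₁ χ₂)
    h1 (Subrepresentation.subtypeIntertwiningMap N) hf0 hw.1 hw.2 a]
  -- `χ(d(a, 1, a⁻¹)) = χ₁(a) · χ₂(det) = χ₁(a)`
  have hdet : torusDetNormOne (conjLocal L (IsCMField.complexConj L) v) (cmLocalForm L 3 v) (cmLocalForm_eq_over L 3 v) a = 1 := by
    apply Subtype.ext
    rw [coe_torusDetNormOne]
    exact torusDet_eq_one_of_torusEntry (conjLocal L (IsCMField.complexConj L) v) (cmLocalForm L 3 v) (cmLocalForm_eq_over L 3 v) a hfix h1a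
  change ‖((torusCharPair (conjLocal L (IsCMField.complexConj L) v) (cmLocalForm L 3 v) (cmLocalForm_eq_over L 3 v) 0 χ₁ χ₂ a : ℂˣ) : ℂ)‖ < 1
  rw [torusCharPair_apply, hdet, map_one, mul_one]
  exact hdecay _ hfix hlt

end Summit.HodgeConjecture.HodgeConjecture.Cruxes.H413.F0P3U3SubrepSquareIntegrableOfExponents

end
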